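import Mathlib
import Literature.Computability.Complexity.CliqueTestGraphs
import Summits.PneNP.PneNP.Theorems.ConvexRankGatesConvexGateBlindColorings

/-!
# PneNP / ConvexRankGates — `ConvexGateBlind`: the matching form of the colouring count

Helpers (`--supports stmt-PneNP-10680`). `ConvexRankGatesConvexGateBlindColorings.lean` bounds the
`(k-1)`-colourings of `K_m` rejected by ONE non-negative threshold certificate `(w, θ)` valid on all
`k`-cliques by counting along `m/k` vertex-disjoint heavy edges (one per block of `k` consecutive
vertices), which gives a rejected fraction `(k-1)^{-m/k + O(k²)}` and needs `k³ = o(m)`. Here the heavy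
edges are chosen GREEDILY: while `≥ k` vertices are uncovered, some `k` of them span a heavy edge
(`exists_heavy_edge_of_le_sum`) — i.e. the heavy graph has independence number `< k` and hence a
matching missing fewer than `k` vertices. With `r = (m-k)/2 + 1` disjoint heavy edges the same count gives
* `card_colorings_sum_lt_le_of_disjoint` — along any `r` disjoint heavy edges, at most
  `k² (r+1)^{k²} (k-1)^{m-r+k²}` colourings are rejected;
* `card_colorings_sum_lt_le_half` — hence at most `k² m^{k²} (k-1)^{(m+k)/2 + k²}` of the `(k-1)^m`
  colourings: a fraction `(k-1)^{-m/2 + O(k²)}`, exponentially small as soon as `k² log k = o(m)`, i.e. for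
  `k = m^δ` with every `δ < 1/2` — exactly the range of `δ` in the crux `ConvexGateBlind`.
[folklore; the route's per-certificate counting with Razborov's colouring negatives]
-/

namespace Summit.PneNP.PneNP.Theorems

open Finset Literature.Computability.Complexity

/-! ### Disjoint heavy edges, greedily -/

/-- **Greedy disjoint heavy edges.** If every `k`-set spans weight `≥ θ > 0` under `w`, then for every `r`
with `2 r + k ≤ m + 2` there are `r` pairwise vertex-disjoint edges of weight `≥ θ / k²` each: having
chosen fewer than that many, at least `k` vertices are uncovered, and any `k` of them span a heavy edge
(`exists_heavy_edge_of_le_sum`). (So the heavy graph, whose independence number is `< k`, has a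
matching on all but at most `k` vertices.) [folklore] -/
theorem exists_disjoint_heavy_edges {m k : ℕ} (w : (⊤ : SimpleGraph (Fin m)).edgeSet → ℝ) {θ : ℝ}
    (hθ : 0 < θ) (hQ : ∀ Q : Finset (Fin m), Q.card = k → θ ≤ ∑ e, if cliqueVec Q e = true then w e else 0) :
    ∀ r : ℕ, 2 * r + k ≤ m + 2 → ∃ f : Fin r → (⊤ : SimpleGraph (Fin m)).edgeSet,
      (∀ i j, i ≠ j → ∀ v, v ∈ (f i : Sym2 (Fin m)) → v ∉ (f j : Sym2 (Fin m))) ∧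
      ∀ i, θ / (k : ℝ) ^ 2 ≤ w (f i) := by
  classical
  intro r
  induction r with
  | zero => exact fun _ => ⟨Fin.elim0, fun i => i.elim0, fun i => i.elim0⟩
  | succ r ih =>
    intro hr
    obtain ⟨f, hdisj, hfw⟩ := ih (by omega)
    -- covered vertices
    set C : Finset (Fin m) := univ.filter fun v => ∃ i, v ∈ (f i : Sym2 (Fin m)) with hC
    have hCcard : C.card ≤ 2 * r := by
      have hend : ∀ i : Fin r, ∃ ab : Fin m × Fin m, (f i : Sym2 (Fin m)) = s(ab.1, ab.2) := by
        intro i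
        obtain ⟨a, b, hab⟩ := sym2_exists_eq_mk (f i : Sym2 (Fin m))
        exact ⟨(a, b), hab⟩
      choose ab hab using hend
      have hsub : C ⊆ (univ.image fun i => (ab i).1) ∪ (univ.image fun i => (ab i).2) := by
        intro v hv
        obtain ⟨i, hi⟩ := (Finset.mem_filter.1 hv).2
        rw [hab i, Sym2.mem_iff] at hi
        rcases hi with h | h
        · exact Finset.mem_union_left _ (Finset.mem_image.2 ⟨i, Finset.mem_univ _, h.symm⟩)
        · exact Finset.mem_union_right _ (Finset.mem_image.2 ⟨i, Finset.mem_univ _, h.symm⟩)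
      calc C.card ≤ ((univ.image fun i => (ab i).1) ∪ (univ.image fun i => (ab i).2)).card :=
            Finset.card_le_card hsub
        _ ≤ (univ.image fun i => (ab i).1).card + (univ.image fun i => (ab i).2).card :=
            Finset.card_union_le _ _
        _ ≤ r + r := Nat.add_le_add (Finset.card_image_le.trans (by simp))
            (Finset.card_image_le.trans (by simp))
        _ = 2 * r := by ring
    -- at least `k` uncovered vertices; `k` of them span a heavy edge
    have hU : k ≤ (univ \ C).card := by
      rw [Finset.card_sdiff_of_subset (Finset.subset_univ C), Finset.card_univ, Fintype.card_fin]
      omega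
    obtain ⟨Q, hQU, hQk⟩ := Finset.exists_subset_card_eq hU
    obtain ⟨e, heQ, hew⟩ := exists_heavy_edge_of_le_sum w hθ Q hQk (hQ Q hQk)
    have heC : ∀ v, v ∈ (e : Sym2 (Fin m)) → v ∉ C := fun v hv =>
      (Finset.mem_sdiff.1 (hQU (heQ v hv))).2
    refine ⟨Matrix.vecCons e f, fun i j hij v => ?_, fun i => ?_⟩
    · rcases Fin.eq_zero_or_eq_succ i with rfl | ⟨i', rfl⟩ <;>
        rcases Fin.eq_zero_or_eq_succ j with rfl | ⟨j', rfl⟩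
      · exact absurd rfl hij
      · -- `v ∈ e`, so `v` is uncovered
        simp only [Matrix.cons_val_zero, Matrix.cons_val_succ]
        intro hv hv'
        exact heC v hv (Finset.mem_filter.2 ⟨Finset.mem_univ _, j', hv'⟩)
      · simp only [Matrix.cons_val_zero, Matrix.cons_val_succ]
        intro hv hv'
        exact heC v hv' (Finset.mem_filter.2 ⟨Finset.mem_univ _, i', hv⟩)
      · simp only [Matrix.cons_val_succ]
        refine hdisj i' j' (fun h => hij ?_) v
        rw [h]
    · rcases Fin.eq_zero_or_eq_succ i with rfl | ⟨i', rfl⟩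
      · simpa using hew
      · simpa using hfw i'

/-! ### Colourings rejected by one certificate, counted along a disjoint heavy family -/

/-- **One threshold certificate rejects few colourings — disjoint-family form.** Given `r` pairwise
vertex-disjoint edges of weight `≥ θ/k²` each (`w ≥ 0`, `k ≥ 2`), the colourings `h : Fin m → Fin (k-1)`
with `w(G_h) < θ` number at most `k² (r+1)^{k²} (k-1)^{m - r + k²}`: fewer than `k²` of the `r` edges are
bichromatic under such an `h`, and the colourings monochromatic on all family edges outside an exceptional
index set `T` inject into the colourings of the vertices that are not the second endpoint of a
non-exceptional edge. (The block family of `card_colorings_sum_lt_le` has `r = m/k`; a near-perfect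
matching has `r ≈ m/2`.) [folklore] -/
theorem card_colorings_sum_lt_le_of_disjoint {m k r : ℕ} (hk : 2 ≤ k)
    (w : (⊤ : SimpleGraph (Fin m)).edgeSet → ℝ) (hw : ∀ e, 0 ≤ w e) {θ : ℝ} (hθ : 0 < θ)
    (f : Fin r → (⊤ : SimpleGraph (Fin m)).edgeSet)
    (hdisj : ∀ i j, i ≠ j → ∀ v, v ∈ (f i : Sym2 (Fin m)) → v ∉ (f j : Sym2 (Fin m)))
    (hfw : ∀ i, θ / (k : ℝ) ^ 2 ≤ w (f i)) :
    (univ.filter fun h : Fin m → Fin (k - 1) =>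
        (∑ e, if colorVec h e = true then w e else 0) < θ).card
      ≤ k ^ 2 * (r + 1) ^ (k ^ 2) * (k - 1) ^ (m - r + k ^ 2) := by
  classical
  -- endpoints `a i ≠ b i` of the family edges
  have hend : ∀ i : Fin r, ∃ ab : Fin m × Fin m, (f i : Sym2 (Fin m)) = s(ab.1, ab.2) ∧ ab.1 ≠ ab.2 := by
    intro i
    obtain ⟨a, b, hab⟩ := sym2_exists_eq_mk (f i : Sym2 (Fin m))
    refine ⟨(a, b), hab, ?_⟩
    have hmem := (f i).2
    rw [hab, SimpleGraph.mem_edgeSet, SimpleGraph.top_adj] at hmem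
    exact hmem
  choose ab hab hne using hend
  have ha_mem : ∀ i, (ab i).1 ∈ (f i : Sym2 (Fin m)) := fun i => by
    rw [hab i]; exact Sym2.mem_mk_left _ _
  have hb_mem : ∀ i, (ab i).2 ∈ (f i : Sym2 (Fin m)) := fun i => by
    rw [hab i]; exact Sym2.mem_mk_right _ _
  have f_inj : Function.Injective f := by
    intro i j hij
    by_contra hne'
    exact hdisj i j hne' _ (ha_mem i) (by rw [← hij]; exact ha_mem i)
  have b_inj : Function.Injective fun i => (ab i).2 := by
    intro i j hij
    by_contra hne'
    refine hdisj i j hne' _ (hb_mem i) ?_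
    simp only at hij
    rw [hij]
    exact hb_mem j
  have a_ne_b : ∀ i j, (ab i).1 ≠ (ab j).2 := by
    intro i j h
    by_cases hij : i = j
    · subst hij
      exact hne i h
    · exact hdisj i j hij _ (ha_mem i) (by rw [h]; exact hb_mem j)
  -- monochromatic family edge `i` under `h`
  have color_ff : ∀ (h : Fin m → Fin (k - 1)) (i : Fin r),
      colorVec h (f i) = false ↔ h (ab i).1 = h (ab i).2 := by
    intro h i
    simp only [colorVec, Bool.not_eq_false', decide_eq_true_eq]
    rw [hab i, Sym2.map_mk, Sym2.mk_isDiag_iff]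
  -- Step 1: a rejected colouring makes fewer than `k²` family edges bichromatic
  have few : ∀ h : Fin m → Fin (k - 1), (∑ e, if colorVec h e = true then w e else 0) < θ →
      (univ.filter fun i : Fin r => colorVec h (f i) = true).card < k ^ 2 := by
    intro h hbad
    set Bi := univ.filter fun i : Fin r => colorVec h (f i) = true with hBi
    have h1 : (Bi.card : ℝ) * (θ / (k : ℝ) ^ 2) ≤ ∑ i ∈ Bi, w (f i) := by
      rw [← nsmul_eq_mul, ← Finset.sum_const]
      exact Finset.sum_le_sum fun i _ => hfw i
    have h2 : ∑ i ∈ Bi, w (f i) ≤ ∑ e, if colorVec h e = true then w e else 0 := by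
      rw [← Finset.sum_image (g := f) (f := fun e => w e) fun i _ j _ hij => f_inj hij,
        ← Finset.sum_filter]
      apply Finset.sum_le_sum_of_subset_of_nonneg
      · intro e he
        obtain ⟨i, hi, rfl⟩ := Finset.mem_image.1 he
        exact Finset.mem_filter.2 ⟨Finset.mem_univ _, (Finset.mem_filter.1 hi).2⟩
      · intro e _ _
        exact hw e
    have hkpos : (0 : ℝ) < (k : ℝ) ^ 2 := by
      have : (2 : ℝ) ≤ k := by exact_mod_cast hk
      positivity
    have h3 : (Bi.card : ℝ) < (k : ℝ) ^ 2 := by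
      by_contra hcon
      push Not at hcon
      have h4 : ((k : ℝ) ^ 2) * (θ / (k : ℝ) ^ 2) ≤ (Bi.card : ℝ) * (θ / (k : ℝ) ^ 2) := by
        gcongr
      have h5 : ((k : ℝ) ^ 2) * (θ / (k : ℝ) ^ 2) = θ := by field_simp
      linarith
    exact_mod_cast h3
  -- Step 2: colourings monochromatic on the family edges outside `T`
  have card_M : ∀ T : Finset (Fin r),
      (univ.filter fun h : Fin m → Fin (k - 1) => ∀ i, i ∉ T → colorVec h (f i) = false).card
        ≤ (k - 1) ^ (m - (r - T.card)) := by
    intro T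
    set BT := (univ \ T).image fun i => (ab i).2 with hBT
    have cardBT : BT.card = r - T.card := by
      rw [hBT, Finset.card_image_of_injective _ b_inj, Finset.card_sdiff_of_subset (Finset.subset_univ T),
        Finset.card_univ, Fintype.card_fin]
    have ha : ∀ i, (ab i).1 ∉ BT := by
      intro i hmem
      obtain ⟨j, _, hj⟩ := Finset.mem_image.1 hmem
      exact a_ne_b i j hj.symm
    set M := univ.filter fun h : Fin m → Fin (k - 1) => ∀ i, i ∉ T → colorVec h (f i) = false with hM
    let φ : {h : Fin m → Fin (k - 1) // h ∈ M} → ({v : Fin m // v ∉ BT} → Fin (k - 1)) :=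
      fun h v => h.1 v.1
    have φ_inj : Function.Injective φ := by
      rintro ⟨h, hh⟩ ⟨h', hh'⟩ heq
      have hh1 := (Finset.mem_filter.1 hh).2
      have hh1' := (Finset.mem_filter.1 hh').2
      apply Subtype.ext
      funext v
      show h v = h' v
      by_cases hv : v ∈ BT
      · obtain ⟨i, hi, rfl⟩ := Finset.mem_image.1 hv
        have hiT : i ∉ T := (Finset.mem_sdiff.1 hi).2
        have e1 : h (ab i).1 = h (ab i).2 := (color_ff h i).1 (hh1 i hiT)
        have e2 : h' (ab i).1 = h' (ab i).2 := (color_ff h' i).1 (hh1' i hiT)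
        have e3 := congrFun heq ⟨(ab i).1, ha i⟩
        simp only [φ] at e3
        rw [← e1, ← e2]
        exact e3
      · exact congrFun heq ⟨v, hv⟩
    have hle := Fintype.card_le_of_injective φ φ_inj
    rw [Fintype.card_coe] at hle
    refine hle.trans (le_of_eq ?_)
    rw [Fintype.card_fun, Fintype.card_fin, Fintype.card_subtype_compl, Fintype.card_fin,
      Fintype.card_coe, cardBT]
  -- Step 3: cover the rejected colourings by the sets of Step 2 over the exceptional sets `T`, `#T < k²`
  set Bad := univ.filter fun h : Fin m → Fin (k - 1) =>
    (∑ e, if colorVec h e = true then w e else 0) < θ with hBad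
  set Ts := (univ : Finset (Fin r)).powerset.filter fun T => T.card < k ^ 2 with hTs
  have cover : Bad ⊆ Ts.biUnion fun T =>
      univ.filter fun h : Fin m → Fin (k - 1) => ∀ i, i ∉ T → colorVec h (f i) = false := by
    intro h hh
    rw [Finset.mem_biUnion]
    refine ⟨univ.filter fun i => colorVec h (f i) = true, ?_, ?_⟩
    · exact Finset.mem_filter.2 ⟨Finset.mem_powerset.2 (Finset.filter_subset _ _),
        few h (Finset.mem_filter.1 hh).2⟩
    · refine Finset.mem_filter.2 ⟨Finset.mem_univ _, fun i hi => ?_⟩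
      simpa using hi
  have cardTs : Ts.card ≤ k ^ 2 * (r + 1) ^ (k ^ 2) := by
    have hsub : Ts ⊆ (range (k ^ 2)).biUnion fun j => powersetCard j (univ : Finset (Fin r)) := by
      intro T hT
      rw [Finset.mem_biUnion]
      exact ⟨T.card, Finset.mem_range.2 (Finset.mem_filter.1 hT).2,
        Finset.mem_powersetCard.2 ⟨Finset.subset_univ _, rfl⟩⟩
    refine (Finset.card_le_card hsub).trans (Finset.card_biUnion_le.trans ?_)
    calc ∑ j ∈ range (k ^ 2), (powersetCard j (univ : Finset (Fin r))).card
        = ∑ j ∈ range (k ^ 2), r.choose j := by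
          refine Finset.sum_congr rfl fun j _ => ?_
          rw [Finset.card_powersetCard, Finset.card_univ, Fintype.card_fin]
      _ ≤ ∑ _j ∈ range (k ^ 2), (r + 1) ^ (k ^ 2) := by
          refine Finset.sum_le_sum fun j hj => ?_
          calc r.choose j ≤ r ^ j := Nat.choose_le_pow _ _
            _ ≤ (r + 1) ^ j := Nat.pow_le_pow_left (Nat.le_succ r) j
            _ ≤ (r + 1) ^ (k ^ 2) := Nat.pow_le_pow_right (Nat.succ_pos r) (Finset.mem_range.1 hj).le
      _ = k ^ 2 * (r + 1) ^ (k ^ 2) := by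
          rw [Finset.sum_const, Finset.card_range, smul_eq_mul]
  have hk1 : 0 < k - 1 := by omega
  calc Bad.card
      ≤ (Ts.biUnion fun T => univ.filter fun h : Fin m → Fin (k - 1) =>
          ∀ i, i ∉ T → colorVec h (f i) = false).card := Finset.card_le_card cover
    _ ≤ ∑ T ∈ Ts, (univ.filter fun h : Fin m → Fin (k - 1) =>
          ∀ i, i ∉ T → colorVec h (f i) = false).card := Finset.card_biUnion_le
    _ ≤ ∑ _T ∈ Ts, (k - 1) ^ (m - r + k ^ 2) := by
        refine Finset.sum_le_sum fun T hT => (card_M T).trans (Nat.pow_le_pow_right hk1 ?_)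
        have := (Finset.mem_filter.1 hT).2
        omega
    _ = Ts.card * (k - 1) ^ (m - r + k ^ 2) := by rw [Finset.sum_const, smul_eq_mul]
    _ ≤ k ^ 2 * (r + 1) ^ (k ^ 2) * (k - 1) ^ (m - r + k ^ 2) := Nat.mul_le_mul_right _ cardTs

/-- **One threshold certificate rejects exponentially few colourings — matching form.** For `2 ≤ k ≤ m`,
`w ≥ 0`, `θ > 0` with every `k`-set spanning weight `≥ θ`, the colourings `h : Fin m → Fin (k-1)` with
`w(G_h) < θ` number at most `k² · m^{k²} · (k-1)^{(m+k)/2 + k²}` out of `(k-1)^m` — the exponent is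
`m/2 + O(k²)` instead of the `m - m/k + k²` of the block count, so the rejected fraction is
`(k-1)^{-m/2 + O(k²)}`, exponentially small as soon as `k² log k = o(m)`, i.e. for `k = m^δ` with any
`δ < 1/2`. (Greedy family of `(m-k)/2 + 1` disjoint heavy edges + `card_colorings_sum_lt_le_of_disjoint`.)
[folklore] -/
theorem card_colorings_sum_lt_le_half {m k : ℕ} (hk : 2 ≤ k) (hkm : k ≤ m)
    (w : (⊤ : SimpleGraph (Fin m)).edgeSet → ℝ) (hw : ∀ e, 0 ≤ w e) {θ : ℝ} (hθ : 0 < θ)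
    (hQ : ∀ Q : Finset (Fin m), Q.card = k → θ ≤ ∑ e, if cliqueVec Q e = true then w e else 0) :
    (univ.filter fun h : Fin m → Fin (k - 1) =>
        (∑ e, if colorVec h e = true then w e else 0) < θ).card
      ≤ k ^ 2 * m ^ (k ^ 2) * (k - 1) ^ ((m + k) / 2 + k ^ 2) := by
  set r := (m - k) / 2 + 1 with hr
  have h2r : 2 * r + k ≤ m + 2 := by omega
  obtain ⟨f, hdisj, hfw⟩ := exists_disjoint_heavy_edges w hθ hQ r h2r
  refine (card_colorings_sum_lt_le_of_disjoint hk w hw hθ f hdisj hfw).trans ?_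
  have hk1 : 0 < k - 1 := by omega
  have hr1 : r + 1 ≤ m := by omega
  have hexp : m - r + k ^ 2 ≤ (m + k) / 2 + k ^ 2 := by omega
  exact Nat.mul_le_mul (Nat.mul_le_mul_left _ (Nat.pow_le_pow_left hr1 _))
    (Nat.pow_le_pow_right hk1 hexp)

end Summit.PneNP.PneNP.Theorems
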